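import Summits.ResolutionOfSingularities.ResolutionOfSingularities.Theorems.EquisingularLiftDefs
import Summits.ResolutionOfSingularities.ResolutionOfSingularities.Theorems.EquisingularLiftEquisingularLiftSplit
import Summits.ResolutionOfSingularities.ResolutionOfSingularities.Theorems.EquisingularLiftEquisingularLiftGoodAtOfSmooth
import Summits.ResolutionOfSingularities.ResolutionOfSingularities.Theorems.EquisingularLiftEquisingularLiftWittRing
import Summits.ResolutionOfSingularities.ResolutionOfSingularities.Theorems.EquisingularLiftEquisingularLiftProjectiveAmbientSmoothProper
import Summits.ResolutionOfSingularities.ResolutionOfSingularities.Theorems.EquisingularLiftEquisingularLiftProjectiveAmbientFibre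
import Summits.ResolutionOfSingularities.ResolutionOfSingularities.Theorems.EquisingularLiftEquisingularLiftReducedStalkOverIso
import Summits.ResolutionOfSingularities.ResolutionOfSingularities.Theorems.EquisingularLiftEquisingularLiftGoodAtOverIso
import Summits.ResolutionOfSingularities.ResolutionOfSingularities.Theorems.EquisingularLiftEquisingularLiftSingFiniteOfLeTwo
import Summits.ResolutionOfSingularities.ResolutionOfSingularities.Theorems.EquisingularLiftEquisingularLiftResolveOnePointDimOne

/-!
# Line `strata-split` — proof skeleton for the crux `EquisingularLift` (stmt-ResolutionOfSingularities-15660)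

Line lead `prover-line-stmt-ResolutionOfSingularities-15660-0` (gen 1, 2026-08-17). The line is the crux-strategist's
STRATA split (`Cruxes/EquisingularLift/StrategySplit.lean`, assembly `Split.equisingularLift_of_subs :
LiftableIsolation → IsolatedPointDrop → EquisingularLift` PROVED; births `Lines/birth_LiftableIsolation.lean`,
`Lines/birth_IsolatedPointDrop.lean`), assembled into ONE skeleton that concludes the crux BY NAME
(`EquisingularLift_of`, `EquisingularLift_proof`). The four payload lines of the opening seat
(`cartier-crystal-centres`, `socle-discrepancy-certificate`, `inseparability-foliation-quotient`,
`ferocious-enlargement`) are lines of OTHER cruxes (FRationalModification, GaloisQuotientModels) mis-seated by a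
truncated crux id and are ineligible here (`PICKED.md`).

## Stubs (7 = stubs_max; `sorry` only inside them) — v2: stubs 1,2,3,6,7 LANDED (imported Theorems files
`EquisingularLiftEquisingularLift{WittRing,ProjectiveAmbientSmoothProper,ProjectiveAmbientFibre,ReducedStalkOverIso,GoodAtOverIso}`,
p158907 / p159079 / p160143 / p159190 / p158978); v2.5: stub 4 reshaped = `stub_goodAtOfSmooth` (LANDED p161858,
`…GoodAtOfSmooth`) + `stub_isolatePositiveDim` (OPEN); v3: Theorems-only imports (Defs p158135, Split p160751);
open: `stub_isolatePositiveDim`, `stub_resolveOnePoint`; v4 (continuation lead c1, 2026-08-17): child-1 stub RESHAPED to its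
∃-form and split by `n` (`stub_singFinite_of_le_two` KNOWN + `stub_liftableIsolation_infinite` OPEN), child-2 stub split by the
dimension of the strict transform (`stub_resolveOnePoint_dimOne` KNOWN classically + `stub_resolveOnePoint_higher` OPEN); helpers
landed by c1: strength certificate p165577 (`Theorems.EquisingularLift.resolutionOverAlgClosed_of_equisingularLift`), regular case p165955;
v4.1: `stub_singFinite_of_le_two` LANDED (p167446, imported `…SingFiniteOfLeTwo`); section-blow-up helpers landed p167199 p167447
p169391 (+charts p168647) p167162 p167608 p167331 (Theorems/EquisingularLiftEquisingularLift{SectionKer,SectionComapPoint,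
SectionBlowupFlatExceptional(Charts),SectionBlowupSpecialFibre,GoodAtOfRegularFibre,ReducedStrictTransformBlowup}); open sorries 3;
v5: `stub_resolveOnePoint_dimOne` LANDED (…ResolveOnePointDimOne, assembled by the lead from the wave-3 helpers IntegralFlatOfGoodAt /
SectionBlowupIrreducible / SectionBlowupGoodAt / SectionBlowupCurveDelta) — open sorries 2 = the two OPEN stubs; EL for n ≤ 2 is a theorem
(Theorems/…CurveCase.lean, `equisingularLift_of_le_two`), and the crux reduces to n ≥ 3 (`equisingularLift_of_ge_three`).

* `stub_wittRing` (KNOWN, S): `O := 𝕎(k)` is a complete DVR of characteristic `0` with algebraically closed residue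
  field and a surjection `O → k` (Mathlib `WittVector.isDiscreteValuationRing`, `isAdicCompleteIdealSpanP`,
  `ker_constantCoeff`; tree `charZero_wittVector`).
* `stub_projectiveAmbientSmoothProper` (KNOWN, M): `ℙⁿ_O = Proj O[x₀…xₙ] → Spec O` is smooth and proper (Mathlib
  `Proj.toSpecZero` proper; charts `(O[x]_{xᵢ})₀ ≅ O[y₁…yₙ]` standard smooth,
  `Literature…ProjectiveSpace.algebraMap_isStandardSmoothOfRelativeDimension`).
* `stub_projectiveAmbientFibre` (KNOWN, M/L): for a local `O` with a surjection `π : O → k` and an integral closed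
  `H ⊆ ℙⁿ_k`: the special fibre of `ℙⁿ_O` is irreducible and contains a closed `Y` with `V(Y) ≅ H`
  (base change `ℙⁿ_k = ℙⁿ_O ×_O k`, `Pullback.range_fst`, reduced closed immersions are isomorphisms onto their
  reduced images).
* `stub_isolateInAmbient` (OPEN — child 1 minus the ambient): liftable horizontal regular blow-ups leave finitely many
  singular points of the reduced strict transform, all at points of good reduction.
* `stub_resolveOnePoint` (OPEN — heart of child 2): one isolated singular point at a point of good reduction is resolved
  by a liftable chain that is an isomorphism over an open containing every other point of the strict transform.
* `stub_reducedStalkOverIso` (STRUCTURAL, M): where `σ₂` is an isomorphism over `V` and two closed sets correspond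
  over `V`, the stalks of their reduced induced subschemes at corresponding points are simultaneously regular.
* `stub_goodAtOverIso` (STRUCTURAL, S/M): where `σ₂` is an isomorphism over `V`, regularity of the ambient stalk and
  "`ϖ` is a regular parameter" are unchanged (stalk map is an isomorphism compatible with germs).

Composition: `ambientLift_of_stubs` (1+2+3) ⟹ with 4: `liftableIsolation_of_stubs : Split.LiftableIsolation`;
`regularOverIso_of_stubs` (6+7+`Split.Chain.fibre`) ⟹ with 5: `isolatedPointDrop_of_stubs : Split.IsolatedPointDrop`
(the birth's injection `Sing₂ ↪ Sing₁ ∖ {x₀}`); `EquisingularLift_of` = `Split.equisingularLift_of_subs`.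

## Landed toolkit toward the two OPEN stubs (all `--supports` this crux, namespace `…Cruxes.EquisingularLift.StrataSplit`)

* `chain_isRegular` (Theorems/EquisingularLiftEquisingularLiftChainRegular.lean, p162649): every stage of a `Split.Chain`
  over a locally Noetherian regular `P` is locally Noetherian and REGULAR (Liu 8.1.19 (a)) and proper over `P`.
* `exists_point_of_isClosed` (…PointOfIsClosed.lean, p163325): a closed point of the special fibre is a `κ`-rational
  point over `Spec κ → Spec O` (`κ` algebraically closed, locally finite type).
* `exists_smooth_nhd_of_goodAt` (…SmoothNhdOfGoodAt.lean, p163543): good reduction (`GoodAt`) at a special-fibre point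
  of a flat, locally finitely presented `P₁ → Spec O` gives a smooth open neighbourhood (Stacks 01V8).
* `exists_section_of_smooth` (…SectionOfSmooth.lean, p162938): HENSEL — a `κ`-point in the smooth locus of
  `P₁ → Spec O`, `O` complete local, extends to an `O`-section: the liftable regular centre `≅ Spec O` through a
  closed point of good reduction, i.e. the first move of any proof of `stub_resolveOnePoint`.
* `stub_goodAtOfSmooth` (…GoodAtOfSmooth.lean, p161858): conversely a smooth `P → Spec O` has `GoodAt` everywhere.
-/

set_option linter.dupNamespace false -- mandated namespace `Summit.<Summit>.<Problem>` of this single-conjunct summit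
set_option linter.overlappingInstances false -- registered signatures carry `[IsDomain O] [IsDiscreteValuationRing O]` (Mathlib's class takes the former as a parameter)

noncomputable section

open CategoryTheory AlgebraicGeometry TopologicalSpace Topology
open Literature.AlgebraicGeometry.Resolution
open Summit.ResolutionOfSingularities.ResolutionOfSingularities.Theses.EquisingularLift.Split

attribute [local instance] MvPolynomial.gradedAlgebra

namespace Summit.ResolutionOfSingularities.ResolutionOfSingularities.Cruxes.EquisingularLift.StrataSplit

/-! ## The stubs -/

/-- **STUB `stub_liftableIsolation_infinite` (OPEN; child 1 in its only contentful case, ∃-form).** For `n ≥ 3` and an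
integral hypersurface `H ⊆ ℙⁿ_k` with INFINITELY many non-regular points: some complete characteristic-0 DVR `O` with
algebraically closed residue field, some smooth proper `P/O`, some `Y ⊆ P_s` with `V(Y) ≅ H`, and some chain of blow-ups in
regular centres off the generic point of `Y` with irreducible special fibre (all centres horizontal = liftable) leave only
FINITELY many non-regular points on the reduced iterated strict transform, each at a point of good reduction. This is
`Split.LiftableIsolation` restricted to its contentful case (v4 reshape of `stub_isolatePositiveDim`, which demanded the same
inside EVERY smooth proper ambient — strictly more than EL needs; worker audit §a.6). Generic liftable embedded resolution along a
positive-dimensional singular locus: OPEN (for `n = 3` the minimal missing move is an `O`-liftable regular CURVE centre through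
the strict transform of each singular curve; for `n ≥ 5` at least as hard as resolution in characteristic `p`,
`Theorems.EquisingularLift.resolutionOverAlgClosed_of_equisingularLift`). Informal sources: Ishii 2025, CJS 2020, Kollár 2007 §3.13. -/
theorem stub_liftableIsolation_infinite : ∀ p : ℕ, p.Prime → ∀ (k : Type) [Field k] [CharP k p] [IsAlgClosed k] (n : ℕ) (H : AlgebraicGeometry.Scheme.{0}) (ι : H ⟶ (Literature.AlgebraicGeometry.Motives.projectiveSpace n k).left), AlgebraicGeometry.IsClosedImmersion ι → AlgebraicGeometry.IsIntegral H → (∀ y : (Literature.AlgebraicGeometry.Motives.projectiveSpace n k).left, ∃ U : (Literature.AlgebraicGeometry.Motives.projectiveSpace n k).left.affineOpens, y ∈ (U : (Literature.AlgebraicGeometry.Motives.projectiveSpace n k).left.Opens) ∧ (ι.ker.ideal U).IsPrincipal) → 3 ≤ n → {x : H | ¬ IsRegularLocalRing (H.presheaf.stalk x)}.Infinite → ∃ (O : Type) (_ : CommRing O) (_ : IsDomain O) (_ : IsDiscreteValuationRing O) (_ : CharZero O) (_ : IsAdicComplete (IsLocalRing.maximalIdeal O) O) (_ : IsAlgClosed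 (IsLocalRing.ResidueField O)) (P P' : AlgebraicGeometry.Scheme.{0}) (q : P ⟶ AlgebraicGeometry.Spec (.of O)) (Y : TopologicalSpace.Closeds P) (σ : P' ⟶ P) (S' : Set P'), AlgebraicGeometry.Smooth q ∧ AlgebraicGeometry.IsProper q ∧ (Y : Set P) ⊆ q ⁻¹' {IsLocalRing.closedPoint O} ∧ Nonempty ((AlgebraicGeometry.Scheme.IdealSheafData.vanishingIdeal Y).subscheme ≅ H) ∧ Chain P (Y : Set P) P' σ S' ∧ IsIrreducible (((CategoryTheory.CategoryStruct.comp σ q)) ⁻¹' {IsLocalRing.closedPoint O}) ∧ (singSet S').Finite ∧ GoodSet ((CategoryTheory.CategoryStruct.comp σ q)) S' := by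
  sorry

/-- **STUB `stub_resolveOnePoint_higher` (OPEN; heart of child 2 in dimension `≥ 2`).** `stub_resolveOnePoint` when
`V(closure S₁)` has dimension `≥ 2`: liftable embedded resolution of one isolated singular point of a surface / higher-dimensional
variety inside the special fibre (centres inside the exceptional loci must be special fibres of regular `O`-flat subschemes;
obstruction `H¹(D, N)` for curve centres; no theorem known already for surfaces in this typing — Disproof.lean §1). Informal
sources: Artin 1977, Hauser–Perlega 2019 §3, Kollár 2026, arXiv:1005.4503 Thm 5. -/
theorem stub_resolveOnePoint_higher : ∀ (O : Type) [CommRing O] [IsDomain O] [IsDiscreteValuationRing O] [CharZero O] [IsAdicComplete (IsLocalRing.maximalIdeal O) O] [IsAlgClosed (IsLocalRing.ResidueField O)] (P P₁ : AlgebraicGeometry.Scheme.{0}) (q : P ⟶ AlgebraicGeometry.Spec (.of O)) (Y : TopologicalSpace.Closeds P) (σ₁ : P₁ ⟶ P) (S₁ : Set P₁), AlgebraicGeometry.Smooth q → AlgebraicGeometry.IsProper q → (Y : Set P) ⊆ q ⁻¹' {IsLocalRing.closedPoint O} → IsIrreducible (Y : Set P) → Chain P (Y : Set P) P₁ σ₁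 S₁ → IsIrreducible (((CategoryTheory.CategoryStruct.comp σ₁ q)) ⁻¹' {IsLocalRing.closedPoint O}) → (singSet S₁).Finite → GoodSet ((CategoryTheory.CategoryStruct.comp σ₁ q)) S₁ → ¬ (topologicalKrullDim ↥(AlgebraicGeometry.Scheme.IdealSheafData.vanishingIdeal (⟨closure S₁, isClosed_closure⟩ : TopologicalSpace.Closeds P₁)).subscheme ≤ 1) → ∀ x₀ ∈ singSet S₁, ∃ (P₂ : AlgebraicGeometry.Scheme.{0}) (σ₂ : P₂ ⟶ P₁) (S₂ : Set P₂), Chain P₁ (closure S₁) P₂ σ₂ S₂ ∧ IsIrreducible (((CategoryTheory.CategoryStruct.comp (CategoryTheory.CategoryStruct.comp σ₂ σ₁) q)) ⁻¹' {IsLocalRing.closedPoint O}) ∧ ∃ V : P₁.Opens, (∀ x : ↥(AlgebraicGeometry.Scheme.IdealSheafData.vanishingIdeal (⟨closure S₁, isClosed_closure⟩ : TopologicalSpace.Closeds P₁)).subscheme, x ≠ x₀ → ((AlgebraicGeometry.Scheme.IdealSheafData.vanishingIdeal (⟨closure S₁, isClosed_closure⟩ : TopologicalSpace.Closeds P₁)).subschemeι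 x : P₁) ∈ V) ∧ CategoryTheory.IsIso (σ₂ ∣_ V) ∧ (∀ z : ↥(AlgebraicGeometry.Scheme.IdealSheafData.vanishingIdeal (⟨closure S₂, isClosed_closure⟩ : TopologicalSpace.Closeds P₂)).subscheme, (σ₂ ((AlgebraicGeometry.Scheme.IdealSheafData.vanishingIdeal (⟨closure S₂, isClosed_closure⟩ : TopologicalSpace.Closeds P₂)).subschemeι z) : P₁) = (AlgebraicGeometry.Scheme.IdealSheafData.vanishingIdeal (⟨closure S₁, isClosed_closure⟩ : TopologicalSpace.Closeds P₁)).subschemeι x₀ → IsRegularLocalRing ((AlgebraicGeometry.Scheme.IdealSheafData.vanishingIdeal (⟨closure S₂, isClosed_closure⟩ : TopologicalSpace.Closeds P₂)).subscheme.presheaf.stalk z)) := by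
  sorry

/-! ## Compositions (kernel-checked; no `sorry` in their own terms) -/

/-- Finiteness of the non-regular locus is transported from `H` to the reduced `V(closure Y) = V(Y) ≅ H`. -/
theorem singSet_finite_of_iso {P H : Scheme.{0}} (Y : TopologicalSpace.Closeds P)
    (e : (AlgebraicGeometry.Scheme.IdealSheafData.vanishingIdeal Y).subscheme ≅ H)
    (hfin : {x : H | ¬ IsRegularLocalRing (H.presheaf.stalk x)}.Finite) : (singSet (Y : Set P)).Finite := by
  -- replace `⟨closure ↑Y, _⟩` by `Y`
  suffices key : ∀ (Z : TopologicalSpace.Closeds P),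
      (⟨closure (Y : Set P), isClosed_closure⟩ : TopologicalSpace.Closeds P) = Z →
      Nonempty ((AlgebraicGeometry.Scheme.IdealSheafData.vanishingIdeal Z).subscheme ≅ H) →
      (singSet (Y : Set P)).Finite from
    key Y (TopologicalSpace.Closeds.ext Y.isClosed.closure_eq) ⟨e⟩
  rintro Z hZ ⟨e'⟩
  subst hZ
  change {x : ↥(AlgebraicGeometry.Scheme.IdealSheafData.vanishingIdeal
      (⟨closure (Y : Set P), isClosed_closure⟩ : TopologicalSpace.Closeds P)).subscheme |
    ¬ IsRegularLocalRing ((AlgebraicGeometry.Scheme.IdealSheafData.vanishingIdeal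
      (⟨closure (Y : Set P), isClosed_closure⟩ : TopologicalSpace.Closeds P)).subscheme.presheaf.stalk x)}.Finite
  have hsub : {x : ↥(AlgebraicGeometry.Scheme.IdealSheafData.vanishingIdeal
      (⟨closure (Y : Set P), isClosed_closure⟩ : TopologicalSpace.Closeds P)).subscheme |
    ¬ IsRegularLocalRing ((AlgebraicGeometry.Scheme.IdealSheafData.vanishingIdeal
      (⟨closure (Y : Set P), isClosed_closure⟩ : TopologicalSpace.Closeds P)).subscheme.presheaf.stalk x)} ⊆
      e'.hom ⁻¹' {x : H | ¬ IsRegularLocalRing (H.presheaf.stalk x)} := by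
    intro x hx hreg
    apply hx
    haveI : IsRegularLocalRing (H.presheaf.stalk (e'.hom x)) := hreg
    exact IsRegularLocalRing.of_ringEquiv (asIso (e'.hom.stalkMap x)).commRingCatIsoToRingEquiv
  exact (hfin.preimage (e'.hom.isClosedEmbedding.injective.injOn)).subset hsub


/-- The ambient lift (birth stub `stub_ambientLift`) from stubs 1–3: `O = 𝕎(k)`, `P = ℙⁿ_O`, `Y =` image of `H`. -/
theorem ambientLift_of_stubs : ∀ p : ℕ, p.Prime → ∀ (k : Type) [Field k] [CharP k p] [IsAlgClosed k] (n : ℕ) (H : AlgebraicGeometry.Scheme.{0}) (ι : H ⟶ (Literature.AlgebraicGeometry.Motives.projectiveSpace n k).left), AlgebraicGeometry.IsClosedImmersion ι → AlgebraicGeometry.IsIntegral H → (∀ y : (Literature.AlgebraicGeometry.Motives.projectiveSpace n k).left, ∃ U : (Literature.AlgebraicGeometry.Motives.projectiveSpace n k).left.affineOpens, y ∈ (U : (Literature.AlgebraicGeometry.Motives.projectiveSpace n k).left.Opens) ∧ (ι.ker.ideal U).IsPrincipal) → ∃ (O : Type) (_ : CommRing O) (_ : IsDomain O) (_ : IsDiscreteValuationRing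 O) (_ : CharZero O) (_ : IsAdicComplete (IsLocalRing.maximalIdeal O) O) (_ : IsAlgClosed (IsLocalRing.ResidueField O)) (P : AlgebraicGeometry.Scheme.{0}) (q : P ⟶ AlgebraicGeometry.Spec (.of O)) (Y : TopologicalSpace.Closeds P), AlgebraicGeometry.Smooth q ∧ AlgebraicGeometry.IsProper q ∧ (Y : Set P) ⊆ q ⁻¹' {IsLocalRing.closedPoint O} ∧ Nonempty ((AlgebraicGeometry.Scheme.IdealSheafData.vanishingIdeal Y).subscheme ≅ H) ∧ IsIrreducible (q ⁻¹' {IsLocalRing.closedPoint O}) := by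
  intro p hp k _ _ _ n H ι hι hH _
  obtain ⟨O, i1, i2, i3, i4, i5, i6, π, hπ⟩ := stub_wittRing p hp k
  obtain ⟨hsm, hprop⟩ := stub_projectiveAmbientSmoothProper O n
  obtain ⟨Y, hY, ⟨e⟩, hirr⟩ := stub_projectiveAmbientFibre O k π hπ n H ι hι hH
  exact ⟨O, i1, i2, i3, i4, i5, i6, _, _, Y, hsm, hprop, hY, ⟨e⟩, hirr⟩

/-- **Child 1 `Split.LiftableIsolation`** from the ambient lift and `stub_isolateInAmbient` (the birth composition). -/
theorem liftableIsolation_of_stubs : LiftableIsolation := by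
  intro p hp k _ _ _ n H ι hι hH hpr
  by_cases hfin : {x : H | ¬ IsRegularLocalRing (H.presheaf.stalk x)}.Finite
  · -- finitely many non-regular points: the ambient lift and the EMPTY chain already isolate
    obtain ⟨O, i1, i2, i3, i4, i5, i6, P, q, Y, hq, hqp, hY, ⟨e⟩, hirr⟩ :=
      ambientLift_of_stubs p hp k n H ι hι hH hpr
    refine ⟨O, i1, i2, i3, i4, i5, i6, P, P, q, Y, CategoryTheory.CategoryStruct.id P, (Y : Set P), hq, hqp, hY, ⟨e⟩,
      fun Q h0 _ => h0, ?_, ?_, ?_⟩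
    · rwa [Category.id_comp]
    · exact singSet_finite_of_iso Y e hfin
    · intro x _
      rw [Category.id_comp]
      exact stub_goodAtOfSmooth O P q hq _
  · by_cases hn : n ≤ 2
    · exact absurd (stub_singFinite_of_le_two p hp k n H ι hι hH hpr hn) hfin
    · obtain ⟨O, i1, i2, i3, i4, i5, i6, P, P', q, Y, σ, S', hq, hqp, hY, hE, hch, hirr', hfin', hgood⟩ :=
        stub_liftableIsolation_infinite p hp k n H ι hι hH hpr (by omega) hfin
      exact ⟨O, i1, i2, i3, i4, i5, i6, P, P', q, Y, σ, S', hq, hqp, hY, hE, hch, hirr', hfin', hgood⟩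

/-- The birth stub `stub_regularOverIso` (regularity of the strict transform and good reduction of the ambient are
unchanged where the chain is an isomorphism), PROVED from `stub_reducedStalkOverIso`, `stub_goodAtOverIso` and the
structure lemma `Split.Chain.fibre` (the two reduced strict transforms agree over `V`). -/
theorem regularOverIso_of_stubs : ∀ (O : Type) [CommRing O] (P₁ P₂ : AlgebraicGeometry.Scheme.{0}) (r₁ : P₁ ⟶ AlgebraicGeometry.Spec (.of O)) (σ₂ : P₂ ⟶ P₁) (S₁ : Set P₁) (S₂ : Set P₂) (V : P₁.Opens), IsIrreducible (closure S₁) → Chain P₁ (closure S₁) P₂ σ₂ S₂ → CategoryTheory.IsIso (σ₂ ∣_ V) → ∀ (z : ↥(AlgebraicGeometry.Scheme.IdealSheafData.vanishingIdeal (⟨closure S₂, isClosed_closure⟩ : TopologicalSpace.Closeds P₂)).subscheme) (x : ↥(AlgebraicGeometry.Scheme.IdealSheafData.vanishingIdeal (⟨closure S₁, isClosed_closure⟩ : TopologicalSpace.Closeds P₁)).subscheme), (σ₂ ((AlgebraicGeometry.Scheme.IdealSheafData.vanishingIdeal (⟨closure S₂, isClosed_closure⟩ : TopologicalSpace.Closeds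 P₂)).subschemeι z) : P₁) = (AlgebraicGeometry.Scheme.IdealSheafData.vanishingIdeal (⟨closure S₁, isClosed_closure⟩ : TopologicalSpace.Closeds P₁)).subschemeι x → ((AlgebraicGeometry.Scheme.IdealSheafData.vanishingIdeal (⟨closure S₁, isClosed_closure⟩ : TopologicalSpace.Closeds P₁)).subschemeι x : P₁) ∈ V → (IsRegularLocalRing ((AlgebraicGeometry.Scheme.IdealSheafData.vanishingIdeal (⟨closure S₂, isClosed_closure⟩ : TopologicalSpace.Closeds P₂)).subscheme.presheaf.stalk z) ↔ IsRegularLocalRing ((AlgebraicGeometry.Scheme.IdealSheafData.vanishingIdeal (⟨closure S₁, isClosed_closure⟩ : TopologicalSpace.Closeds P₁)).subscheme.presheaf.stalk x)) ∧ (GoodAt ((CategoryTheory.CategoryStruct.comp σ₂ r₁)) ((AlgebraicGeometry.Scheme.IdealSheafData.vanishingIdeal (⟨closure S₂, isClosed_closure⟩ : TopologicalSpace.Closeds P₂)).subschemeι z) ↔ GoodAt r₁ ((AlgebraicGeometry.Scheme.IdealSheafData.vanishingIdeal (⟨closure S₁, isClosed_closure⟩ : TopologicalSpace.Closeds P₁)).subschemeι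 x)) := by
  intro O _ P₁ P₂ r₁ σ₂ S₁ S₂ V hirr hch hiso z x hzx hxV
  -- generic points: `closure S₁ = closure {ξ₁}`, `S₂ = closure {ξ₂}`, `σ₂ ⁻¹' {ξ₁} = {ξ₂}`
  obtain ⟨ξ₁, hξ₁⟩ : ∃ ξ₁ : P₁, IsGenericPoint ξ₁ (closure S₁) := QuasiSober.sober hirr isClosed_closure
  obtain ⟨ξ₂, hfib, hS₂⟩ := Chain.fibre hch hξ₁
  have hcl₁ : closure S₁ = closure {ξ₁} := hξ₁.symm
  have hcl₂ : closure S₂ = closure {ξ₂} := by rw [hS₂, closure_closure]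
  have hσξ₂ : σ₂ ξ₂ = ξ₁ := by
    have : ξ₂ ∈ σ₂ ⁻¹' {ξ₁} := by rw [hfib]; rfl
    simpa using this
  -- the two closed sets agree over `V`
  have hsets : ((⟨closure S₂, isClosed_closure⟩ : TopologicalSpace.Closeds P₂) : Set P₂) ∩ σ₂ ⁻¹' (V : Set P₁) =
      σ₂ ⁻¹' ((⟨closure S₁, isClosed_closure⟩ : TopologicalSpace.Closeds P₁) : Set P₁) ∩ σ₂ ⁻¹' (V : Set P₁) := by
    ext y
    change y ∈ closure S₂ ∩ σ₂ ⁻¹' (V : Set P₁) ↔ y ∈ σ₂ ⁻¹' (closure S₁) ∩ σ₂ ⁻¹' (V : Set P₁)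
    constructor
    · rintro ⟨hy, hyV⟩
      refine ⟨?_, hyV⟩
      rw [hcl₂] at hy
      have h' : σ₂ y ∈ closure (σ₂ '' {ξ₂}) := image_closure_subset_closure_image σ₂.continuous ⟨y, hy, rfl⟩
      rw [Set.image_singleton, hσξ₂] at h'
      show σ₂ y ∈ closure S₁
      rwa [hcl₁]
    · rintro ⟨hy, hyV⟩
      refine ⟨?_, hyV⟩
      have hy' : y ∈ σ₂ ⁻¹' closure {ξ₁} := by
        show σ₂ y ∈ closure {ξ₁}
        rw [← hcl₁]; exact hy
      have h' := preimage_closure_inter_subset σ₂ hiso {ξ₁} ⟨hy', hyV⟩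
      rw [hfib] at h'
      show y ∈ closure S₂
      rwa [hcl₂]
  refine ⟨stub_reducedStalkOverIso P₁ P₂ σ₂ V hiso _ _ hsets z x hzx hxV, ?_⟩
  exact stub_goodAtOverIso P₁ P₂ σ₂ V hiso _ _ hzx hxV O r₁

/-- `stub_resolveOnePoint` (v3) recovered from its two v4 halves by a case split on the dimension of the reduced strict
transform. -/
theorem resolveOnePoint_of_stubs : ∀ (O : Type) [CommRing O] [IsDomain O] [IsDiscreteValuationRing O] [CharZero O] [IsAdicComplete (IsLocalRing.maximalIdeal O) O] [IsAlgClosed (IsLocalRing.ResidueField O)] (P P₁ : AlgebraicGeometry.Scheme.{0}) (q : P ⟶ AlgebraicGeometry.Spec (.of O)) (Y : TopologicalSpace.Closeds P) (σ₁ : P₁ ⟶ P) (S₁ : Set P₁), AlgebraicGeometry.Smooth q → AlgebraicGeometry.IsProper q → (Y : Set P) ⊆ q ⁻¹' {IsLocalRing.closedPoint O} → IsIrreducible (Y : Set P) → Chain P (Y : Set P) P₁ σ₁ S₁ → IsIrreducible (((CategoryTheory.CategoryStruct.comp σ₁ q)) ⁻¹' {IsLocalRing.closedPoint O}) → (singSet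 S₁).Finite → GoodSet ((CategoryTheory.CategoryStruct.comp σ₁ q)) S₁ → ∀ x₀ ∈ singSet S₁, ∃ (P₂ : AlgebraicGeometry.Scheme.{0}) (σ₂ : P₂ ⟶ P₁) (S₂ : Set P₂), Chain P₁ (closure S₁) P₂ σ₂ S₂ ∧ IsIrreducible (((CategoryTheory.CategoryStruct.comp (CategoryTheory.CategoryStruct.comp σ₂ σ₁) q)) ⁻¹' {IsLocalRing.closedPoint O}) ∧ ∃ V : P₁.Opens, (∀ x : ↥(AlgebraicGeometry.Scheme.IdealSheafData.vanishingIdeal (⟨closure S₁, isClosed_closure⟩ : TopologicalSpace.Closeds P₁)).subscheme, x ≠ x₀ → ((AlgebraicGeometry.Scheme.IdealSheafData.vanishingIdeal (⟨closure S₁, isClosed_closure⟩ : TopologicalSpace.Closeds P₁)).subschemeι x : P₁) ∈ V) ∧ CategoryTheory.IsIso (σ₂ ∣_ V) ∧ (∀ z : ↥(AlgebraicGeometry.Scheme.IdealSheafData.vanishingIdeal (⟨closure S₂, isClosed_closure⟩ : TopologicalSpace.Closeds P₂)).subscheme, (σ₂ ((AlgebraicGeometry.Scheme.IdealSheafData.vanishingIdeal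 (⟨closure S₂, isClosed_closure⟩ : TopologicalSpace.Closeds P₂)).subschemeι z) : P₁) = (AlgebraicGeometry.Scheme.IdealSheafData.vanishingIdeal (⟨closure S₁, isClosed_closure⟩ : TopologicalSpace.Closeds P₁)).subschemeι x₀ → IsRegularLocalRing ((AlgebraicGeometry.Scheme.IdealSheafData.vanishingIdeal (⟨closure S₂, isClosed_closure⟩ : TopologicalSpace.Closeds P₂)).subscheme.presheaf.stalk z)) := by
  intro O _ _ _ _ _ _ P P₁ q Y σ₁ S₁ hq hqp hY hYirr hch hirr hfin hgood x₀ hx₀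
  by_cases hdim : topologicalKrullDim ↥(AlgebraicGeometry.Scheme.IdealSheafData.vanishingIdeal (⟨closure S₁, isClosed_closure⟩ : TopologicalSpace.Closeds P₁)).subscheme ≤ 1
  · exact stub_resolveOnePoint_dimOne O P P₁ q Y σ₁ S₁ hq hqp hY hYirr hch hirr hfin hgood hdim x₀ hx₀
  · exact stub_resolveOnePoint_higher O P P₁ q Y σ₁ S₁ hq hqp hY hYirr hch hirr hfin hgood hdim x₀ hx₀

/-- **Child 2 `Split.IsolatedPointDrop`** from `stub_resolveOnePoint` and `regularOverIso_of_stubs` (the birth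
composition: the non-regular points of the new strict transform inject into the old ones minus `x₀`, inheriting good
reduction). -/
theorem isolatedPointDrop_of_stubs : IsolatedPointDrop := by
  classical
  have h1 := resolveOnePoint_of_stubs
  have h2 := regularOverIso_of_stubs
  intro O _ _ _ _ _ _ P P₁ q Y σ₁ S₁ hq hqp hY hYirr hch₁ hirr₁ hfin₁ hgood₁ hne
  obtain ⟨x₀, hx₀⟩ := hne
  obtain ⟨P₂, σ₂, S₂, hch₂, hirr₂, V, hV, hiso, hreg₀⟩ :=
    h1 O P P₁ q Y σ₁ S₁ hq hqp hY hYirr hch₁ hirr₁ hfin₁ hgood₁ x₀ hx₀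
  -- generic points: `Y = closure {ξ}`, `closure S₁ = closure {ξ₁}`, `S₂ = closure {ξ₂}`, `σ₂ ξ₂ = ξ₁`
  obtain ⟨ξ, hξ⟩ : ∃ ξ : P, IsGenericPoint ξ (Y : Set P) := QuasiSober.sober hYirr Y.isClosed
  obtain ⟨ξ₁, hfib₁, hS₁⟩ := Chain.fibre hch₁ hξ
  have hcl₁ : closure S₁ = closure {ξ₁} := by rw [hS₁, closure_closure]
  have hgen₁ : IsGenericPoint ξ₁ (closure S₁) := by rw [isGenericPoint_def, hcl₁]
  have hirrS₁ : IsIrreducible (closure S₁) := by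
    rw [hcl₁]; exact isIrreducible_singleton.closure
  obtain ⟨ξ₂, hfib₂, hS₂⟩ := Chain.fibre hch₂ hgen₁
  have hσξ₂ : σ₂ ξ₂ = ξ₁ := by
    have : ξ₂ ∈ σ₂ ⁻¹' {ξ₁} := by rw [hfib₂]; rfl
    simpa using this
  -- the two reduced strict transforms and their inclusions
  have hrange₁ : Set.range (AlgebraicGeometry.Scheme.IdealSheafData.vanishingIdeal (⟨closure S₁, isClosed_closure⟩ : TopologicalSpace.Closeds P₁)).subschemeι = closure S₁ := by
    rw [Scheme.IdealSheafData.range_subschemeι, Scheme.IdealSheafData.coe_support_vanishingIdeal]; rfl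
  have hrange₂ : Set.range (AlgebraicGeometry.Scheme.IdealSheafData.vanishingIdeal (⟨closure S₂, isClosed_closure⟩ : TopologicalSpace.Closeds P₂)).subschemeι = closure S₂ := by
    rw [Scheme.IdealSheafData.range_subschemeι, Scheme.IdealSheafData.coe_support_vanishingIdeal]; rfl
  -- every point of the new strict transform lies over the old one
  have hcl₂ : closure S₂ = closure {ξ₂} := by rw [hS₂, closure_closure]
  have himg : ∀ z : ↥(AlgebraicGeometry.Scheme.IdealSheafData.vanishingIdeal (⟨closure S₂, isClosed_closure⟩ : TopologicalSpace.Closeds P₂)).subscheme, (σ₂ ((AlgebraicGeometry.Scheme.IdealSheafData.vanishingIdeal (⟨closure S₂, isClosed_closure⟩ : TopologicalSpace.Closeds P₂)).subschemeι z) : P₁) ∈ closure S₁ := by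
    intro z
    have hz : ((AlgebraicGeometry.Scheme.IdealSheafData.vanishingIdeal (⟨closure S₂, isClosed_closure⟩ : TopologicalSpace.Closeds P₂)).subschemeι z : P₂) ∈ closure S₂ := (Set.ext_iff.mp hrange₂ _).mp (Set.mem_range_self z)
    have hz' : ((AlgebraicGeometry.Scheme.IdealSheafData.vanishingIdeal (⟨closure S₂, isClosed_closure⟩ : TopologicalSpace.Closeds P₂)).subschemeι z : P₂) ∈ closure ({ξ₂} : Set P₂) := (Set.ext_iff.mp hcl₂ _).mp hz
    have h' : (σ₂ ((AlgebraicGeometry.Scheme.IdealSheafData.vanishingIdeal (⟨closure S₂, isClosed_closure⟩ : TopologicalSpace.Closeds P₂)).subschemeι z) : P₁) ∈ closure (σ₂ '' {ξ₂}) :=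
      image_closure_subset_closure_image σ₂.continuous ⟨_, hz', rfl⟩
    rw [Set.image_singleton, hσξ₂] at h'
    exact (Set.ext_iff.mp hcl₁ _).mpr h'
  have hx : ∀ z : ↥(AlgebraicGeometry.Scheme.IdealSheafData.vanishingIdeal (⟨closure S₂, isClosed_closure⟩ : TopologicalSpace.Closeds P₂)).subscheme, ∃ x : ↥(AlgebraicGeometry.Scheme.IdealSheafData.vanishingIdeal (⟨closure S₁, isClosed_closure⟩ : TopologicalSpace.Closeds P₁)).subscheme, ((AlgebraicGeometry.Scheme.IdealSheafData.vanishingIdeal (⟨closure S₁, isClosed_closure⟩ : TopologicalSpace.Closeds P₁)).subschemeι x : P₁) = σ₂ ((AlgebraicGeometry.Scheme.IdealSheafData.vanishingIdeal (⟨closure S₂, isClosed_closure⟩ : TopologicalSpace.Closeds P₂)).subschemeι z) := by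
    intro z
    have hz : (σ₂ ((AlgebraicGeometry.Scheme.IdealSheafData.vanishingIdeal (⟨closure S₂, isClosed_closure⟩ : TopologicalSpace.Closeds P₂)).subschemeι z) : P₁) ∈ Set.range (AlgebraicGeometry.Scheme.IdealSheafData.vanishingIdeal (⟨closure S₁, isClosed_closure⟩ : TopologicalSpace.Closeds P₁)).subschemeι := (Set.ext_iff.mp hrange₁ _).mpr (himg z)
    obtain ⟨x, hx⟩ := hz
    exact ⟨x, hx⟩
  choose f hf using hx
  -- `f` maps the new non-regular points into the old ones minus `x₀`, injectively
  have hne₀ : ∀ z ∈ singSet S₂, f z ≠ x₀ := by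
    intro z hz h0
    exact hz (hreg₀ z (by rw [← hf z, h0]))
  have hfV : ∀ z ∈ singSet S₂, ((AlgebraicGeometry.Scheme.IdealSheafData.vanishingIdeal (⟨closure S₁, isClosed_closure⟩ : TopologicalSpace.Closeds P₁)).subschemeι (f z) : P₁) ∈ V := fun z hz => hV (f z) (hne₀ z hz)
  have hmaps : ∀ z ∈ singSet S₂, f z ∈ singSet S₁ \ {x₀} := by
    intro z hz
    refine ⟨?_, hne₀ z hz⟩
    intro hreg
    exact hz ((h2 O P₁ P₂ ((CategoryTheory.CategoryStruct.comp σ₁ q)) σ₂ S₁ S₂ V hirrS₁ hch₂ hiso z (f z) (hf z).symm (hfV z hz)).1.mpr hreg)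
  have hinj : Set.InjOn f (singSet S₂) := by
    intro z hz z' hz' hzz'
    obtain ⟨w, -, huniq⟩ := existsUnique_preimage σ₂ hiso (hfV z hz)
    have e1 : ((AlgebraicGeometry.Scheme.IdealSheafData.vanishingIdeal (⟨closure S₂, isClosed_closure⟩ : TopologicalSpace.Closeds P₂)).subschemeι z : P₂) = w := huniq _ (hf z).symm
    have e2 : ((AlgebraicGeometry.Scheme.IdealSheafData.vanishingIdeal (⟨closure S₂, isClosed_closure⟩ : TopologicalSpace.Closeds P₂)).subschemeι z' : P₂) = w := huniq _ (by rw [hzz', hf z'])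
    exact (AlgebraicGeometry.Scheme.IdealSheafData.vanishingIdeal (⟨closure S₂, isClosed_closure⟩ : TopologicalSpace.Closeds P₂)).subschemeι.isClosedEmbedding.injective (e1.trans e2.symm)
  have hfin' : (singSet S₁ \ {x₀}).Finite := hfin₁.subset Set.sdiff_subset
  have hfin₂ : (singSet S₂).Finite := by
    have himf : (f '' singSet S₂).Finite := hfin'.subset (by rintro _ ⟨z, hz, rfl⟩; exact hmaps z hz)
    exact (Set.finite_image_iff hinj).mp himf
  have hle : (singSet S₂).ncard ≤ (singSet S₁ \ {x₀}).ncard := Set.ncard_le_ncard_of_injOn f hmaps hinj hfin'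
  have hlt : (singSet S₁ \ {x₀}).ncard < (singSet S₁).ncard := Set.ncard_sdiff_singleton_lt_of_mem hx₀ hfin₁
  -- good reduction at the remaining non-regular points is inherited from the points under them
  have hgood₂ : GoodSet ((CategoryTheory.CategoryStruct.comp (CategoryTheory.CategoryStruct.comp σ₂ σ₁) q)) S₂ := by
    intro z hz
    have hg : GoodAt ((CategoryTheory.CategoryStruct.comp σ₁ q)) ((AlgebraicGeometry.Scheme.IdealSheafData.vanishingIdeal (⟨closure S₁, isClosed_closure⟩ : TopologicalSpace.Closeds P₁)).subschemeι (f z)) := hgood₁ (f z) (hmaps z hz).1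
    have ht := (h2 O P₁ P₂ ((CategoryTheory.CategoryStruct.comp σ₁ q)) σ₂ S₁ S₂ V hirrS₁ hch₂ hiso z (f z) (hf z).symm (hfV z hz)).2.mpr hg
    rwa [← Category.assoc] at ht
  exact ⟨P₂, σ₂, S₂, hch₂, hirr₂, hfin₂, hgood₂, lt_of_le_of_lt hle hlt⟩

/-! ## The crux -/

/-- **`EquisingularLift` from the seven stub statements** (conclusion = the route decl, by name). -/
theorem EquisingularLift_of :
    Summit.ResolutionOfSingularities.ResolutionOfSingularities.Theses.EquisingularLift.EquisingularLift :=
  equisingularLift_of_subs liftableIsolation_of_stubs isolatedPointDrop_of_stubs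

/-- The crux, assembled (only `sorry`s in its closure: the registered stubs). -/
theorem EquisingularLift_proof :
    Summit.ResolutionOfSingularities.ResolutionOfSingularities.Theses.EquisingularLift.EquisingularLift :=
  EquisingularLift_of

end Summit.ResolutionOfSingularities.ResolutionOfSingularities.Cruxes.EquisingularLift.StrataSplit

end
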